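import Summits.QuantumFields.YangMills.Theorems.BalabanUVNodesN07ChartDDecayHerm0
import Summits.QuantumFields.YangMills.Theorems.BalabanUVNodesN07ChartDDecayRefBond
import HarnessLib

/-!
# BalabanUVNodes ∕ N07 — (73) IN PRINT's LITERAL KERNEL SHAPE ON THE UNIFIED PACKAGE (decay **and** `𝔤`-reality, ONE `(H, Dfun)`) AT NODE 00's RECORD: the reference-bond twist and
# the kernel entries `‖𝔇(δ_b·a)(j,c)‖ ≤ 4C₃ε·e^{2δ}·w₁(b)‖a‖·e^{−δ·distBI D b (j,c)}` — generation 4's `…ChartDDecayRefBond` §3∕§4 RE-RUN VERBATIM on `N07ChartDDecayHerm0.exists_chartD_decay_herm0_T4`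

Cell `pub-ymgap`, width seat `pub-ymgap-dag-n07-w2` generation 6 (HUMAN RULING D-0149; DAG node N07 = [15] = [Balaban1985Variational]; W-SEAT START LIST §n07 item 2 = S2
«[15] Sect. C (47)–(49), Prop. 3 at objects»; the (t2)-edition of FILE 5's unified package a Sect. D consumer of (85)–(86) reads: kernel ENTRIES).  `--kind proof --supports
stmt-QuantumFields-27364 --as helper` (K1⁹ face per KEY MAP v2; count-neutral).  CONSUMED BY NAME, nothing modified: this seat's `N07ChartDDecayHerm0.exists_chartD_decay_herm0_T4`
(FILE 5 of generation 6) and generation 4's reference-bond slacks `N07ChartDDecayRefBond.{refTwist_triangle, refTwist_index_slack, refTwist_block_slack, refTwist_read_slack}`;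
lit-balaban `B5Prop12FieldsLattice.distSite`.

WHAT IS PROVED (sorry-free; no definition; axioms standard).  ★★★ `exists_chartD_decay_herm0_T4_refBond` — FILE 5's record package (right inverse, sup letter `3B₀′`, `H` herm0-preserving,
(55)∕(49)∕(48)∕`HasFDerivAt`∕(73) norm, reality under the guard) with the every-twist conjunct SPECIALISED to the canonical twist «scaled distance to a reference fine bond `b₀`»:
`‖𝔇W (j,c)‖ ≤ 4C₃ε·e^{δ(r+2)}·t·e^{−δ·distBI D b₀ (j,c)}` for `W` of weighted size `≤ t` supported within scaled distance `r` of `b₀`, `0 ≤ δ ≤ ½δ₀`, under `4C₃e^{3δ}·3B_e(δ)·ε ≤ 1`;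
★★★★ `exists_chartD_kernelEntry_decay_herm0_T4` — the kernel entries: **`‖𝔇(δ_b·a)(j,c)‖ ≤ 4C₃ε·e^{2δ}·w₁(b)‖a‖·e^{−δ·distBI D b (j,c)}`** on the SAME `(H, Dfun)` that is `𝔤`-valued.

HONEST FRAMING: count-neutral helper; generation 4's proofs re-run by name on the unified package (constants ×3) — NO new estimate of [15]; nothing of Sects. D–F; stub 1 ∕ K0⁷ ∕
K1⁹ NOT closed; N07 NOT discharged; counts unmoved; one finite T⁴ programme at fixed ε — NOT continuum ∕ ℝ⁴ ∕ OS ∕ mass gap ∕ Clay: the Yang–Mills mass gap is NOT proved by any of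
this; R4 closes the conditional rung `BalabanLadder.UV` only.  No `sorry`, no `def`, no `instance`, no `notation`.

References: [15] T. Bałaban, CMP 102 (1985) 277–309 [Balaban1985Variational] ((66) p.288, (73) + Prop. 3 p.289, (161)–(162) p.303); [3] = [B6] CMP 96 (1984) 223–250
[Balaban1984PropagatorsII] (Cor. 2.8 p.249).
-/

noncomputable section

open scoped BigOperators Matrix.Norms.L2Operator ContDiff

namespace Summit.QuantumFields.YangMills.BalabanUVNodes.N07ChartDDecayHerm0RefBond

open Literature.MathematicalPhysics.QuantumFieldTheory.Balaban1983to89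
open Literature.MathematicalPhysics.QuantumFieldTheory.Balaban1983to89.T4Continuum (T4Family)
open Literature.MathematicalPhysics.QuantumFieldTheory.Balaban1983to89.B9AdOrthogonal (herm0)
open Literature.MathematicalPhysics.QuantumFieldTheory.Balaban1983to89.ExpMeanLog (deltaSU)
open B5Eq118OneStroke (iterBlockOf)
open B5Eq117TorusCarriers (Mk)
open B5Prop12FieldsLattice (distSite distSite_self distSite_nonneg)
open B6SectADomainsV1 (Domains)
open B6SectAOperatorsV1 (BondIdx)
open Summit.QuantumFields.YangMills.Theorems.FlatCubeOpsText (Adm22 distBI)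
open Summit.QuantumFields.YangMills.Theorems.K0FlatCubeOpsTextP (IsLevWeight levWeight_nonneg)
open Summit.QuantumFields.YangMills.Theorems.Prop8Chart (chartLog)
open Summit.QuantumFields.YangMills.BalabanUVNodes.N07ChartDDecayRefBond (refTwist_triangle refTwist_index_slack refTwist_block_slack refTwist_read_slack)
open Summit.QuantumFields.YangMills.BalabanUVNodes.N07ChartDDecayHerm0 (exists_chartD_decay_herm0_T4)

variable {N : ℕ} [NeZero N]

/-- ★★★ **FILE 5's UNIFIED PACKAGE WITH THE REFERENCE-BOND TWIST** — generation 4's `exists_chartD_decay_T4_refBond` re-run verbatim on `exists_chartD_decay_herm0_T4` (constants ×3):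
the `𝔤`-valued `H`, the chart `Dfun` with (55)∕(49)∕(48)∕(73), reality under the guard, and `‖𝔇W (j,c)‖ ≤ 4C₃ε·e^{δ(r+2)}·t·e^{−δ·distBI D b₀ (j,c)}` for directions of weighted size
`≤ t` supported within scaled distance `r` of the reference bond `b₀`. [cite: Balaban1985Variational, (73) p.289, Prop. 3 p.289, (161)-(162) p.303; Balaban1984PropagatorsII, Cor. 2.8 p.249] -/
theorem exists_chartD_decay_herm0_T4_refBond (F : T4Family) :
    ∃ (Mh₀ R₀ : ℕ) (CK δ₀ B₃ : ℝ), 0 ≤ CK ∧ 0 < δ₀ ∧ 0 < B₃ ∧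
    ∀ (n K : ℕ) (_ : 1 ≤ K - n) (_ : K - n + 1 ≤ F.m + K) {Mh R a' : ℕ} (_ : Mh = F.L ^ a') (_ : Mh₀ ≤ Mh) (_ : R₀ ≤ R) (_ : 2 * F.L ≤ R)
      (_ : a' + 3 ≤ F.m + n) (D : Domains (F.P K)) (_ : D.k = K - n) (_ : Adm22 D R (F.L * Mh))
      (w : ℕ → PBond (F.P K) 0 → ℝ) (_ : IsLevWeight (F.P K) (K - n) D w) {ε : ℝ} (_ : 0 < ε)
      (_ : 18 * (960 * ((((F.P K).d + 2) * (F.P K).L : ℕ) : ℝ) * ((F.P K).L : ℝ) / (12800 * ((((F.P K).d + 2) * (F.P K).L : ℕ) : ℝ) ^ 2 * ((F.P K).L : ℝ))⁻¹) *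
        (3 * (CK * B₃ * (1 + 2 * (((F.P K).d + 2) * (F.P K).L : ℕ)) * (1 + 2 * (((F.P K).d + 2) * (F.P K).L : ℕ) * (1 + (F.P K).L)))) * ε ≤ 1)
      (_ : 64 * ε ≤ (12800 * ((((F.P K).d + 2) * (F.P K).L : ℕ) : ℝ) ^ 2 * ((F.P K).L : ℝ))⁻¹),
      let η : ℝ := (((F.P K).L : ℝ)⁻¹) ^ (K - n)
      let Rs : ℝ := (12800 * ((((F.P K).d + 2) * (F.P K).L : ℕ) : ℝ) ^ 2 * ((F.P K).L : ℝ))⁻¹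
      let C₂ : ℝ := 960 * ((((F.P K).d + 2) * (F.P K).L : ℕ) : ℝ) * ((F.P K).L : ℝ) / Rs
      let C₃ : ℝ := 3840 * ((((F.P K).d + 2) * (F.P K).L : ℕ) : ℝ) * ((F.P K).L : ℝ) / Rs
      let Qlin := (fderiv ℂ (chartLog η D : (PBond (F.P K) 0 → Matrix (Fin N) (Fin N) ℂ) → BondIdx D → Matrix (Fin N) (Fin N) ℂ) 0)
      ∃ (H : (BondIdx D → Matrix (Fin N) (Fin N) ℂ) →ₗ[ℂ] (PBond (F.P K) 0 → Matrix (Fin N) (Fin N) ℂ))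
        (Dfun : (PBond (F.P K) 0 → Matrix (Fin N) (Fin N) ℂ) → (BondIdx D → Matrix (Fin N) (Fin N) ℂ)),
        (∀ X, Qlin (H X) = X) ∧
        (∀ (X : BondIdx D → Matrix (Fin N) (Fin N) ℂ) (t : ℝ), 0 ≤ t → (∀ i, ‖X i‖ ≤ t) → ∀ b,
          w 1 b * ‖H X b‖ ≤ 3 * (CK * B₃ * (1 + 2 * (((F.P K).d + 2) * (F.P K).L : ℕ)) * (1 + 2 * (((F.P K).d + 2) * (F.P K).L : ℕ) * (1 + (F.P K).L))) * t) ∧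
        (∀ X : BondIdx D → Matrix (Fin N) (Fin N) ℂ, (∀ i, X i ∈ herm0 (Fin N)) → ∀ b, H X b ∈ herm0 (Fin N)) ∧
        DifferentiableOn ℂ Dfun {A' : PBond (F.P K) 0 → Matrix (Fin N) (Fin N) ℂ | ∀ b, w 1 b * ‖A' b‖ < ε} ∧
        ContDiffOn ℂ ω Dfun {A' : PBond (F.P K) 0 → Matrix (Fin N) (Fin N) ℂ | ∀ b, w 1 b * ‖A' b‖ < ε} ∧
        DifferentiableOn ℂ (fderiv ℂ Dfun) {A' : PBond (F.P K) 0 → Matrix (Fin N) (Fin N) ℂ | ∀ b, w 1 b * ‖A' b‖ < ε} ∧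
        (∀ A' : PBond (F.P K) 0 → Matrix (Fin N) (Fin N) ℂ, (∀ b, w 1 b * ‖A' b‖ < ε) →
          (∀ (ρ : ℝ), 0 ≤ ρ → (∀ b, w 1 b * ‖A' b‖ ≤ ρ) → ∀ i, ‖Dfun A' i‖ ≤ 4 * C₂ * ρ ^ 2) ∧
          chartLog η D (A' - H (Dfun A')) - Qlin (A' - H (Dfun A')) = Dfun A' ∧
          chartLog η D (A' - H (Dfun A')) = Qlin A' ∧
          ∃ 𝔇 : (PBond (F.P K) 0 → Matrix (Fin N) (Fin N) ℂ) →L[ℂ] (BondIdx D → Matrix (Fin N) (Fin N) ℂ), HasFDerivAt Dfun 𝔇 A' ∧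
            (∀ (W : PBond (F.P K) 0 → Matrix (Fin N) (Fin N) ℂ) (t : ℝ), 0 ≤ t → (∀ b, w 1 b * ‖W b‖ ≤ t) → ∀ i, ‖𝔇 W i‖ ≤ 4 * C₃ * ε * t) ∧
            ∀ (b₀ : PBond (F.P K) 0) (δ : ℝ), 0 ≤ δ → δ ≤ δ₀ / 2 →
              4 * C₃ * Real.exp (δ * 3) *
                  (3 * (CK * B₃ * (1 + 2 * (((F.P K).d + 2) * (F.P K).L : ℕ) * Real.exp (δ * 4)) *
                    (1 + 2 * (((F.P K).d + 2) * (F.P K).L : ℕ) * (1 + (F.P K).L) * Real.exp (δ * 1)))) * ε ≤ 1 →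
              ∀ (W : PBond (F.P K) 0 → Matrix (Fin N) (Fin N) ℂ) (t r : ℝ), 0 ≤ t → (∀ b, w 1 b * ‖W b‖ ≤ t) →
                (∀ b : PBond (F.P K) 0, r < (((F.P K).L : ℝ)⁻¹) ^ D.k * distSite (Mk (F.P K) 0) b.src b₀.src → W b = 0) →
                ∀ i, ‖𝔇 W i‖ ≤ 4 * C₃ * ε * Real.exp (δ * (r + 2)) * t * Real.exp (-(δ * distBI D b₀ i))) ∧
        ((120 * ((((F.P K).d + 2) * (F.P K).L : ℕ) : ℝ) ^ 2 * ((F.P K).L : ℝ) * ε < deltaSU (Fin N)) →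
          ∀ A' : PBond (F.P K) 0 → Matrix (Fin N) (Fin N) ℂ, (∀ b, w 1 b * ‖A' b‖ < ε) → (∀ b, A' b ∈ herm0 (Fin N)) →
            (∀ i, Dfun A' i ∈ herm0 (Fin N)) ∧ ∀ b, (A' - H (Dfun A')) b ∈ herm0 (Fin N))  := by
  obtain ⟨Mh₀, R₀, CK, δ₀, B₃, hCK, hδ₀, hB₃, hmain⟩ := exists_chartD_decay_herm0_T4 (N := N) F
  refine ⟨Mh₀, R₀, CK, δ₀, B₃, hCK, hδ₀, hB₃, ?_⟩
  intro n K hk1 hk' Mh R a' hMha hMh hR h2L hsize D hDk hAdm w hw ε hε h18 h2 η Rs C₂ C₃ Qlin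
  obtain ⟨H, Dfun, hHinv, hsup, hherm, hdiff, hω, hfd, hDfun, hreal⟩ := hmain n K hk1 hk' hMha hMh hR h2L hsize D hDk hAdm w hw hε h18 h2
  refine ⟨H, Dfun, hHinv, hsup, hherm, hdiff, hω, hfd, fun A' hA' => ?_, hreal⟩
  obtain ⟨h55, h49, h48, 𝔇, h𝔇, h73, htw⟩ := hDfun A' hA'
  refine ⟨h55, h49, h48, 𝔇, h𝔇, h73, fun b₀ δ hδ hδh hsmall W t r ht hW hsupp i => ?_⟩
  -- adapted verbatim from generation 4's `N07ChartDDecayRefBond.exists_chartD_decay_T4_refBond`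
  have hWe : ∀ b : PBond (F.P K) 0,
      Real.exp (δ * ((((F.P K).L : ℝ)⁻¹) ^ D.k * distSite (Mk (F.P K) 0) b.src b₀.src - 1)) * (w 1 b * ‖W b‖) ≤ Real.exp (δ * (r - 1)) * t := by
    intro b
    by_cases hb : r < (((F.P K).L : ℝ)⁻¹) ^ D.k * distSite (Mk (F.P K) 0) b.src b₀.src
    · rw [hsupp b hb, norm_zero, mul_zero, mul_zero]; positivity
    · exact mul_le_mul (Real.exp_le_exp.mpr (by nlinarith [not_lt.mp hb])) (hW b)
        (mul_nonneg (levWeight_nonneg hw 1 b) (norm_nonneg _)) (Real.exp_pos _).le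
  have h := htw (fun b => (((F.P K).L : ℝ)⁻¹) ^ D.k * distSite (Mk (F.P K) 0) b.src b₀.src - 1) (fun c => distBI D b₀ c) δ 3 4 1 hδ hδh
    (fun b c => refTwist_triangle D b₀ b c) (fun i' c x hi hc => refTwist_index_slack D b₀ i' c x hi hc)
    (fun b b' x j hx hj hblk => refTwist_block_slack D b₀ b b' x j hx hj hblk) (fun idx b hs _ => refTwist_read_slack D b₀ idx b hs)
    hsmall W (Real.exp (δ * (r - 1)) * t) (by positivity) hWe i
  have hi : 0 < Real.exp (δ * distBI D b₀ i) := Real.exp_pos _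
  rw [Real.exp_neg, ← div_eq_mul_inv, le_div_iff₀ hi, mul_comm]
  calc Real.exp (δ * distBI D b₀ i) * ‖𝔇 W i‖ ≤ 4 * C₃ * Real.exp (δ * 3) * ε * (Real.exp (δ * (r - 1)) * t) := h
    _ = 4 * C₃ * ε * (Real.exp (δ * 3) * Real.exp (δ * (r - 1))) * t := by ring
    _ = 4 * C₃ * ε * Real.exp (δ * (r + 2)) * t := by rw [← Real.exp_add]; ring_nf

/-- ★★★★ **THE KERNEL ENTRIES OF `𝔇` ON THE UNIFIED PACKAGE** — generation 4's `exists_chartD_kernelEntry_decay_T4` re-run verbatim: on the SAME `𝔤`-valued `(H, Dfun)` of FILE 5, for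
every fine bond `b`, matrix `a`, rate `0 ≤ δ ≤ ½δ₀` in the window and index `(j,c)`: **`‖𝔇(δ_b·a)(j,c)‖ ≤ 4C₃ε·e^{2δ}·w₁(b)‖a‖·e^{−δ·distBI D b (j,c)}`** — print's
«|𝔇(A′; c, b)| ≦ O(1)C₃ε₃(Lʲη)^{−d+1}e^{−(1/2)δ₀d(c₋,y)}». [cite: Balaban1985Variational, (66) p.288, (73) p.289, Prop. 3 p.289, (161) p.303] -/
theorem exists_chartD_kernelEntry_decay_herm0_T4 (F : T4Family) :
    ∃ (Mh₀ R₀ : ℕ) (CK δ₀ B₃ : ℝ), 0 ≤ CK ∧ 0 < δ₀ ∧ 0 < B₃ ∧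
    ∀ (n K : ℕ) (_ : 1 ≤ K - n) (_ : K - n + 1 ≤ F.m + K) {Mh R a' : ℕ} (_ : Mh = F.L ^ a') (_ : Mh₀ ≤ Mh) (_ : R₀ ≤ R) (_ : 2 * F.L ≤ R)
      (_ : a' + 3 ≤ F.m + n) (D : Domains (F.P K)) (_ : D.k = K - n) (_ : Adm22 D R (F.L * Mh))
      (w : ℕ → PBond (F.P K) 0 → ℝ) (_ : IsLevWeight (F.P K) (K - n) D w) {ε : ℝ} (_ : 0 < ε)
      (_ : 18 * (960 * ((((F.P K).d + 2) * (F.P K).L : ℕ) : ℝ) * ((F.P K).L : ℝ) / (12800 * ((((F.P K).d + 2) * (F.P K).L : ℕ) : ℝ) ^ 2 * ((F.P K).L : ℝ))⁻¹) *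
        (3 * (CK * B₃ * (1 + 2 * (((F.P K).d + 2) * (F.P K).L : ℕ)) * (1 + 2 * (((F.P K).d + 2) * (F.P K).L : ℕ) * (1 + (F.P K).L)))) * ε ≤ 1)
      (_ : 64 * ε ≤ (12800 * ((((F.P K).d + 2) * (F.P K).L : ℕ) : ℝ) ^ 2 * ((F.P K).L : ℝ))⁻¹),
      let η : ℝ := (((F.P K).L : ℝ)⁻¹) ^ (K - n)
      let Rs : ℝ := (12800 * ((((F.P K).d + 2) * (F.P K).L : ℕ) : ℝ) ^ 2 * ((F.P K).L : ℝ))⁻¹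
      let C₂ : ℝ := 960 * ((((F.P K).d + 2) * (F.P K).L : ℕ) : ℝ) * ((F.P K).L : ℝ) / Rs
      let C₃ : ℝ := 3840 * ((((F.P K).d + 2) * (F.P K).L : ℕ) : ℝ) * ((F.P K).L : ℝ) / Rs
      let Qlin := (fderiv ℂ (chartLog η D : (PBond (F.P K) 0 → Matrix (Fin N) (Fin N) ℂ) → BondIdx D → Matrix (Fin N) (Fin N) ℂ) 0)
      ∃ (H : (BondIdx D → Matrix (Fin N) (Fin N) ℂ) →ₗ[ℂ] (PBond (F.P K) 0 → Matrix (Fin N) (Fin N) ℂ))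
        (Dfun : (PBond (F.P K) 0 → Matrix (Fin N) (Fin N) ℂ) → (BondIdx D → Matrix (Fin N) (Fin N) ℂ)),
        (∀ X, Qlin (H X) = X) ∧
        (∀ (X : BondIdx D → Matrix (Fin N) (Fin N) ℂ) (t : ℝ), 0 ≤ t → (∀ i, ‖X i‖ ≤ t) → ∀ b,
          w 1 b * ‖H X b‖ ≤ 3 * (CK * B₃ * (1 + 2 * (((F.P K).d + 2) * (F.P K).L : ℕ)) * (1 + 2 * (((F.P K).d + 2) * (F.P K).L : ℕ) * (1 + (F.P K).L))) * t) ∧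
        (∀ X : BondIdx D → Matrix (Fin N) (Fin N) ℂ, (∀ i, X i ∈ herm0 (Fin N)) → ∀ b, H X b ∈ herm0 (Fin N)) ∧
        DifferentiableOn ℂ Dfun {A' : PBond (F.P K) 0 → Matrix (Fin N) (Fin N) ℂ | ∀ b, w 1 b * ‖A' b‖ < ε} ∧
        ContDiffOn ℂ ω Dfun {A' : PBond (F.P K) 0 → Matrix (Fin N) (Fin N) ℂ | ∀ b, w 1 b * ‖A' b‖ < ε} ∧
        DifferentiableOn ℂ (fderiv ℂ Dfun) {A' : PBond (F.P K) 0 → Matrix (Fin N) (Fin N) ℂ | ∀ b, w 1 b * ‖A' b‖ < ε} ∧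
        (∀ A' : PBond (F.P K) 0 → Matrix (Fin N) (Fin N) ℂ, (∀ b, w 1 b * ‖A' b‖ < ε) →
          (∀ (ρ : ℝ), 0 ≤ ρ → (∀ b, w 1 b * ‖A' b‖ ≤ ρ) → ∀ i, ‖Dfun A' i‖ ≤ 4 * C₂ * ρ ^ 2) ∧
          chartLog η D (A' - H (Dfun A')) - Qlin (A' - H (Dfun A')) = Dfun A' ∧
          chartLog η D (A' - H (Dfun A')) = Qlin A' ∧
          ∃ 𝔇 : (PBond (F.P K) 0 → Matrix (Fin N) (Fin N) ℂ) →L[ℂ] (BondIdx D → Matrix (Fin N) (Fin N) ℂ), HasFDerivAt Dfun 𝔇 A' ∧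
            (∀ (W : PBond (F.P K) 0 → Matrix (Fin N) (Fin N) ℂ) (t : ℝ), 0 ≤ t → (∀ b, w 1 b * ‖W b‖ ≤ t) → ∀ i, ‖𝔇 W i‖ ≤ 4 * C₃ * ε * t) ∧
            ∀ (b : PBond (F.P K) 0) (a : Matrix (Fin N) (Fin N) ℂ) (δ : ℝ), 0 ≤ δ → δ ≤ δ₀ / 2 →
              4 * C₃ * Real.exp (δ * 3) *
                  (3 * (CK * B₃ * (1 + 2 * (((F.P K).d + 2) * (F.P K).L : ℕ) * Real.exp (δ * 4)) *
                    (1 + 2 * (((F.P K).d + 2) * (F.P K).L : ℕ) * (1 + (F.P K).L) * Real.exp (δ * 1)))) * ε ≤ 1 →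
              ∀ i, ‖𝔇 (Pi.single b a) i‖ ≤ 4 * C₃ * ε * Real.exp (δ * 2) * (w 1 b * ‖a‖) * Real.exp (-(δ * distBI D b i))) ∧
        ((120 * ((((F.P K).d + 2) * (F.P K).L : ℕ) : ℝ) ^ 2 * ((F.P K).L : ℝ) * ε < deltaSU (Fin N)) →
          ∀ A' : PBond (F.P K) 0 → Matrix (Fin N) (Fin N) ℂ, (∀ b, w 1 b * ‖A' b‖ < ε) → (∀ b, A' b ∈ herm0 (Fin N)) →
            (∀ i, Dfun A' i ∈ herm0 (Fin N)) ∧ ∀ b, (A' - H (Dfun A')) b ∈ herm0 (Fin N))  := by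
  classical
  obtain ⟨Mh₀, R₀, CK, δ₀, B₃, hCK, hδ₀, hB₃, hmain⟩ := exists_chartD_decay_herm0_T4_refBond (N := N) F
  refine ⟨Mh₀, R₀, CK, δ₀, B₃, hCK, hδ₀, hB₃, ?_⟩
  intro n K hk1 hk' Mh R a' hMha hMh hR h2L hsize D hDk hAdm w hw ε hε h18 h2 η Rs C₂ C₃ Qlin
  obtain ⟨H, Dfun, hHinv, hsup, hherm, hdiff, hω, hfd, hDfun, hreal⟩ := hmain n K hk1 hk' hMha hMh hR h2L hsize D hDk hAdm w hw hε h18 h2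
  refine ⟨H, Dfun, hHinv, hsup, hherm, hdiff, hω, hfd, fun A' hA' => ?_, hreal⟩
  obtain ⟨h55, h49, h48, 𝔇, h𝔇, h73, href⟩ := hDfun A' hA'
  refine ⟨h55, h49, h48, 𝔇, h𝔇, h73, fun b a δ hδ hδh hsmall i => ?_⟩
  -- adapted verbatim from generation 4's `N07ChartDDecayRefBond.exists_chartD_kernelEntry_decay_T4`
  have hwnn : ∀ b', 0 ≤ w 1 b' := levWeight_nonneg hw 1
  have hW : ∀ b', w 1 b' * ‖(Pi.single b a : PBond (F.P K) 0 → Matrix (Fin N) (Fin N) ℂ) b'‖ ≤ w 1 b * ‖a‖ := by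
    intro b'
    by_cases hb' : b' = b
    · subst hb'; rw [Pi.single_eq_same]
    · rw [Pi.single_eq_of_ne (M := fun _ : PBond (F.P K) 0 => Matrix (Fin N) (Fin N) ℂ) hb', norm_zero, mul_zero]; exact mul_nonneg (hwnn b) (norm_nonneg a)
  have hsupp : ∀ b' : PBond (F.P K) 0, (0 : ℝ) < (((F.P K).L : ℝ)⁻¹) ^ D.k * distSite (Mk (F.P K) 0) b'.src b.src →
      (Pi.single b a : PBond (F.P K) 0 → Matrix (Fin N) (Fin N) ℂ) b' = 0 := by
    intro b' hb'
    by_cases hbb : b' = b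
    · subst hbb; rw [distSite_self, mul_zero] at hb'; exact absurd hb' (lt_irrefl _)
    · exact Pi.single_eq_of_ne (M := fun _ : PBond (F.P K) 0 => Matrix (Fin N) (Fin N) ℂ) hbb a
  have h := href b δ hδ hδh hsmall (Pi.single b a) (w 1 b * ‖a‖) 0 (mul_nonneg (hwnn b) (norm_nonneg a)) hW hsupp i
  simpa only [zero_add] using h

end Summit.QuantumFields.YangMills.BalabanUVNodes.N07ChartDDecayHerm0RefBond

end
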